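import Literature.AlgebraicGeometry.Hironaka2017.Proofs.S04CharAlgebra.Itm411
import Literature.AlgebraicGeometry.Hironaka2017.Proofs.S04CharAlgebra.Itm413
import Literature.AlgebraicGeometry.Hironaka2017.Proofs.S04CharAlgebra.U19L29
import Literature.AlgebraicGeometry.Hironaka2017.S04CharAlgebra.R005bEdgeData
import Literature.AlgebraicGeometry.Hironaka2017.EdgeInvOfSubalgebra
import Summits.ResolutionOfSingularities.ResolutionOfSingularities.Theorems.MarkedTransferCampaignW31EdgeHilbertLsc
import Mathlib.RingTheory.Length
import HarnessLib

/-!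
# [OURS · L1 W3.1] THE EDGE-PIECE BRIDGE: `dim_{κ(ξ)} G(ξ)_a` (typed `CampaignW31.edgeHilbAt`) = the Hilbert function of the
# `κ(ξ)`-subalgebra of `κ(ξ)[Z]` with carrier row 004's `edgeG (℘(E)_ξ) z` (seat res-L1-s31-pv-3; toward piece (ii)
# `CampaignW31EdgeHilbDictionary` of slot W3.1)

Cell `res-hironaka` (run/shared/lean/pub/res-hironaka/), rung L (rescue) of LADDER-RESOLUTION, slot W3.1 «u.s.c. first»
(positive rung, verdict-free). HOST (custody, no new route): the existing crux `Theses.MarkedTransfer.HypersurfaceOrderReduction`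
stmt-ResolutionOfSingularities-16155, `--supports … --as helper`, as every W3.1 file. Companion of the statement files
p463247 / p464862 (o4), the assembly p467881 (k31), (i) `CampaignW31EdgeHilbLsc_holds` p474858 (pv-2) and
`campaignW31InvWellDefinedI_holds` p472731 (res-type-005).

HONEST FRAMING. Everything below is commutative algebra about OUR typed carriers — row 003's `pAlg`/`familySubalgebra`,
row 004's `inBl`/`nu`/`edgeAlgebra`/`polyMap`/`edgeG`/`pStalk`, the companion's `edgeHilbAt` — and the tree's libraries
(`Resolution.ReesRing`/`FibreCone`, the HIRONAKA-L discharge lane's `S04CharAlgebra.EdgeCone.*` of Itm411/Itm413 and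
`S04CharAlgebra.coeff_mem_of_mem_familySubalgebra` / `stalkIdeal_pAlg_mul_le` of U19L29, the lane-Lib `pAlg_mul_le`,
`EdgeAlgebra.hilbFun`). NOTHING here is a statement of H. Hironaka's manuscript *Resolution of singularities in positive
characteristics* (2017-03-23, [Hironaka2017], lit key `paper:url-3343fd9e678b`); no candidate statement of it is a premise;
no FACT-LIST fact is consumed. AI-produced; weaker than expert review.

## Why (the plan for piece (ii), DOSSIER group-3 §1 R13)

`CampaignW31EdgeHilbDictionary p` (p464862) compares `CampaignW31.edgeHilbAt E ξ a` — the `O_ξ`-LENGTH of the image of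
`℘(E,a)_ξ ∩ 𝔪^a` in `O_ξ/𝔪^{a+1}` — with `N(q(D); a)` for Def. 4.9 edge data `D`, whose provenance predicate `IsEdgeData` is
phrased in the polynomial ring `κ(ξ)[Z_1,…,Z_n]` through `polyMap z` (row 004: the set `edgeG (℘(E)_ξ) z`, its positive
homogeneous part `edgeGPos`, `IsMinHomogGens`). This file moves `edgeHilbAt` into that polynomial ring: it equals
`dim_κ (U ∩ κ[Z]_a)` (tree `EdgeAlgebra.hilbFun U a`) for the `κ`-subalgebra `U` with carrier `edgeG (℘(E)_ξ) z`, and `U` is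
GRADED. The next file adds Hasse–Schmidt stability of `U` (typed candidate `U19_4` as a HYPOTHESIS) and the tree's structure
theorem `Resolution.exists_eq_adjoin_pow_linearForms_of_isDiffStable` to conclude (ii).

## What is proved (sorry-free; axioms ⊆ {propext, Classical.choice, Quot.sound})

Local ring `(O, 𝔪, κ)`, family `A : ℕ → Ideal O` with `A 0 = ⊤`, `A b · A c ⊆ A (b + c)` (shape of `d ↦ ℘(E,d)_ξ`),
`P = familySubalgebra O A = ⊕ A_d X^d`, system `z : Fin n → O` generating `𝔪`:
* `nu_blMonomial_mem_edgeAlgebra_iff` — **membership criterion**: for `x ∈ 𝔪^a`, `ν(x X^a) ∈ edgeAlgebra P` iff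
  `x ∈ (A a ∩ 𝔪^a) + 𝔪^{a+1}`; `sub_mem_pow_succ_of_nu_blMonomial_eq` — `ν(xX^a) = ν(yX^a) ⇒ x − y ∈ 𝔪^{a+1}`.
* `exists_subalgebra_coe_eq_edgeG` — `edgeG P z` is the carrier of a `κ`-subalgebra `U ⊆ κ[Z]`;
  `isGradedSubalgebra_of_coe_eq_edgeG` — `U` contains the homogeneous components of its members.
* `length_edgePiece_eq_hilbFun` — for `O` regular with regular system of parameters `z` (`n = emb.dim`):
  `length_O ((A_a ∩ 𝔪^a + 𝔪^{a+1})/𝔪^{a+1}) = dim_κ (U ∩ κ[Z]_a)`, through the `O`-linear bijection `F ↦ F̃(z) mod 𝔪^{a+1}`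
  (well defined and injective by the previous bullet and Matsumura 17.10 = tree `EdgeCone.polyMap_injective`; onto by the
  criterion; then `Module.length_eq_of_surjective` along `O ↠ κ` and `Module.length_eq_finrank`).
Scheme level (regular locally Noetherian `Z`, point `ξ`, `IsRSP z`, `↑U = edgeG (pStalk E ξ) z`):
* **`edgeHilbAt_eq_hilbFun`**: `CampaignW31.edgeHilbAt E ξ a = EdgeAlgebra.hilbFun U a`; **`isGradedSubalgebra_edgeG`**.

## References (context only; nothing below is a premise)

* H. Hironaka, ms. 2017-03-23, §4.1 (1)–(8) p.18–19, Def. 4.6 p.19 l.33–37, Def. 4.9 p.20 — scope only, under adjudication.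
  [Hironaka2017]
* H. Matsumura, *Commutative Ring Theory*, CUP 1986, Thm. 17.10. [Matsumura1987]
-/

noncomputable section

set_option linter.dupNamespace false -- mandated namespace of this single-conjunct summit

open scoped Polynomial
open IsLocalRing

namespace Summit.ResolutionOfSingularities.ResolutionOfSingularities.Theorems

open Literature.AlgebraicGeometry.Resolution
open Literature.AlgebraicGeometry.Hironaka2017
open Literature.AlgebraicGeometry.Hironaka2017.S02Preliminaries
open Literature.AlgebraicGeometry.Hironaka2017.S04CharAlgebra

universe u

namespace CampaignW31

/-! ## The membership criterion for `ν(℘(E)_ξ)` in one degree -/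

section Criterion

variable {O : Type u} [CommRing O] [IsLocalRing O]

/-- Membership in `P ∩ bl_ξ(Z)` (row 004's `inBl`) is membership of the underlying polynomial in `P`. [folklore] -/
theorem mem_inBl_iff (P : Subalgebra O O[X]) (b : ReesRing (maximalIdeal O)) :
    b ∈ inBl P ↔ ReesRing.poly (maximalIdeal O) b ∈ P := Iff.rfl

/-- `poly` is compatible with subtraction. [folklore] -/
theorem poly_sub (b c : ReesRing (maximalIdeal O)) :
    ReesRing.poly (maximalIdeal O) (b - c) = ReesRing.poly _ b - ReesRing.poly _ c :=
  map_sub (ReesRing.polyAddHom (maximalIdeal O)) b c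

/-- Difference of two homogeneous elements `x X^a − y X^a = (x − y) X^a` of `bl_ξ(Z, a)`. [folklore] -/
theorem blMonomial_sub (a : ℕ) (x y : O) (hx : x ∈ maximalIdeal O ^ a) (hy : y ∈ maximalIdeal O ^ a) :
    blMonomial a x hx - blMonomial a y hy = blMonomial a (x - y) (sub_mem hx hy) :=
  ReesRing.ext _ (by rw [poly_sub, blMonomial, blMonomial, blMonomial, ReesRing.poly_tMonomial,
    ReesRing.poly_tMonomial, ReesRing.poly_tMonomial, map_sub])

/-- `ν(x X^a) = ν(y X^a)` forces `x − y ∈ 𝔪^{a+1}` (degree-`a` coefficient of an element of `𝔪·bl_ξ(Z)`, tree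
`EdgeCone.coeff_mem_pow_succ_of_mem_reesMaxExt`). [folklore] -/
theorem sub_mem_pow_succ_of_nu_blMonomial_eq {a : ℕ} {x y : O} (hx : x ∈ maximalIdeal O ^ a)
    (hy : y ∈ maximalIdeal O ^ a) (h : nu O (blMonomial a x hx) = nu O (blMonomial a y hy)) :
    x - y ∈ maximalIdeal O ^ (a + 1) := by
  have hdiff := (EdgeCone.nu_eq_nu_iff _ _).1 h
  rw [blMonomial_sub] at hdiff
  have hc := EdgeCone.coeff_mem_pow_succ_of_mem_reesMaxExt hdiff a
  rwa [blMonomial, ReesRing.poly_tMonomial, Polynomial.coeff_monomial, if_pos rfl] at hc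

/-- **Membership criterion.** For a family `A` of ideals with `A 0 = ⊤`, `A b · A c ⊆ A (b + c)` (the shape of
`d ↦ ℘(E,d)_ξ`) and `x ∈ 𝔪^a`: the class `ν(x X^a)` lies in the edge algebra `ν(P ∩ bl_ξ(Z))` (row 004's `edgeAlgebra`)
of `P = ⊕ A_d X^d` (row 003's `familySubalgebra`) iff `x ∈ (A a ∩ 𝔪^a) + 𝔪^{a+1}`: the degree-`a` piece of the edge
algebra is `(A_a ∩ 𝔪^a + 𝔪^{a+1}) / 𝔪^{a+1}`. [folklore] -/
theorem nu_blMonomial_mem_edgeAlgebra_iff (A : ℕ → Ideal O) (h0 : A 0 = ⊤)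
    (hmul : ∀ b c, A b * A c ≤ A (b + c)) (a : ℕ) {x : O} (hx : x ∈ maximalIdeal O ^ a) :
    nu O (blMonomial a x hx) ∈ edgeAlgebra (familySubalgebra O A) ↔
      x ∈ A a ⊓ maximalIdeal O ^ a ⊔ maximalIdeal O ^ (a + 1) := by
  constructor
  · intro h
    obtain ⟨b, hb, hbx⟩ := Subalgebra.mem_map.1 h
    have hdiff : b - blMonomial a x hx ∈ reesMaxExt (maximalIdeal O) := (EdgeCone.nu_eq_nu_iff _ _).1 hbx
    have hc := EdgeCone.coeff_mem_pow_succ_of_mem_reesMaxExt hdiff a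
    rw [poly_sub, Polynomial.coeff_sub, blMonomial, ReesRing.poly_tMonomial, Polynomial.coeff_monomial, if_pos rfl]
      at hc
    have hA : (ReesRing.poly _ b).coeff a ∈ A a :=
      S04CharAlgebra.coeff_mem_of_mem_familySubalgebra A h0 hmul ((mem_inBl_iff _ _).1 hb) a
    have hm : (ReesRing.poly _ b).coeff a ∈ maximalIdeal O ^ a := ReesRing.coeff_poly_mem _ b a
    exact Submodule.mem_sup.2 ⟨(ReesRing.poly _ b).coeff a, ⟨hA, hm⟩,
      -((ReesRing.poly _ b).coeff a - x), neg_mem hc, by ring⟩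
  · intro h
    obtain ⟨y, ⟨hyA, hym⟩, w, hw, hyw⟩ := Submodule.mem_sup.1 h
    refine Subalgebra.mem_map.2 ⟨blMonomial a y hym, ?_, ?_⟩
    · rw [mem_inBl_iff, blMonomial, ReesRing.poly_tMonomial]
      exact Algebra.subset_adjoin ⟨a, y, hyA, rfl⟩
    · have hyx : y - x ∈ maximalIdeal O ^ (a + 1) := by
        have e : y - x = -w := by rw [← hyw]; ring
        exact e ▸ neg_mem hw
      exact EdgeCone.nu_blMonomial_eq_of_sub_mem hym hx hyx

end Criterion

/-! ## The edge algebra pulled back to `κ[Z]` as a `κ`-subalgebra; its gradedness -/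

section Subalgebra

variable {O : Type u} [CommRing O] [IsLocalRing O] {n : ℕ}
  (z : Fin n → O) (hz : Ideal.span (Set.range z) = maximalIdeal O)

/-- Row 004's SET `edgeG P z` (the preimage of the edge algebra `ν(P ∩ bl_ξ(Z))` under `polyMap z : κ[Z] → bl/𝔪bl`) is
the carrier of a `κ`-subalgebra of `κ[Z_1, …, Z_n]` (`κ` = residue field of `O_ξ`). [folklore] -/
theorem exists_subalgebra_coe_eq_edgeG (P : Subalgebra O O[X]) :
    ∃ U : Subalgebra (ResidueField O) (MvPolynomial (Fin n) (ResidueField O)), (U : Set _) = edgeG P z hz := by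
  refine ⟨{ ((edgeAlgebra P).toSubring.comap (polyMap z hz)) with
    algebraMap_mem' := fun c => ?_ }, rfl⟩
  obtain ⟨r, rfl⟩ := residue_surjective c
  show polyMap z hz (algebraMap _ _ (residue O r)) ∈ edgeAlgebra P
  rw [MvPolynomial.algebraMap_eq, polyMap, MvPolynomial.coe_eval₂Hom, MvPolynomial.eval₂_C,
    fibreConeResidueMap_residue]
  exact Subalgebra.mem_map.2 ⟨_, Subalgebra.algebraMap_mem _ r, rfl⟩

/-- **Gradedness.** For `P = ⊕ A_d X^d` (`A 0 = ⊤`, `A b · A c ⊆ A (b + c)`), the `κ`-subalgebra of `κ[Z]` with carrier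
`edgeG P z` contains the homogeneous components of its members (tree `Resolution.IsGradedSubalgebra`): lift the
components to forms over `O_ξ`, read the degree-`e` coefficient of a preimage in `P ∩ bl_ξ(Z)` modulo `𝔪·bl_ξ(Z)`, and
apply the membership criterion degree by degree. [folklore] -/
theorem isGradedSubalgebra_of_coe_eq_edgeG (A : ℕ → Ideal O) (h0 : A 0 = ⊤) (hmul : ∀ b c, A b * A c ≤ A (b + c))
    {U : Subalgebra (ResidueField O) (MvPolynomial (Fin n) (ResidueField O))}
    (hU : (U : Set _) = edgeG (familySubalgebra O A) z hz) : IsGradedSubalgebra U := by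
  classical
  intro F hF e
  have hFU : F ∈ edgeG (familySubalgebra O A) z hz := by rw [← hU]; exact hF
  obtain ⟨b, hb, hbF⟩ := Subalgebra.mem_map.1 hFU
  -- lift the homogeneous components of `F`
  set N := F.totalDegree
  choose G hG hGF using fun e : ℕ =>
    EdgeCone.exists_lift_isHomogeneous (O := O) _ (MvPolynomial.homogeneousComponent_isHomogeneous e F)
  have hsum : F = ∑ e ∈ Finset.range (N + 1), MvPolynomial.homogeneousComponent e F :=
    (MvPolynomial.sum_homogeneousComponent F).symm
  set B := ∑ e ∈ Finset.range (N + 1),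
    MvPolynomial.aeval (fun i => blMonomial 1 (z i) (EdgeCone.mem_pow_one z hz i)) (G e) with hB
  have hpolyF : polyMap z hz F = nu O B := by
    conv_lhs => rw [hsum]
    rw [map_sum, hB, map_sum]
    exact Finset.sum_congr rfl fun e _ => by rw [← hGF e, EdgeCone.polyMap_map_residue]
  -- `b − B ∈ 𝔪·bl_ξ(Z)`; compare degree-`e` coefficients
  have hdiff : b - B ∈ reesMaxExt (maximalIdeal O) := (EdgeCone.nu_eq_nu_iff _ _).1 (hbF.trans hpolyF)
  have hcoeffB : ∀ e ∈ Finset.range (N + 1), (ReesRing.poly (maximalIdeal O) B).coeff e = MvPolynomial.eval z (G e) := by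
    intro e he
    rw [hB, ← ReesRing.polyAddHom_apply, map_sum, Polynomial.finsetSum_coeff]
    simp only [ReesRing.polyAddHom_apply]
    rw [Finset.sum_eq_single e]
    · rw [EdgeCone.poly_blSubst z hz, EdgeCone.aeval_CX_of_isHomogeneous z (hG e), Polynomial.coeff_monomial,
        if_pos rfl]
    · intro e' _ hne
      rw [EdgeCone.poly_blSubst z hz, EdgeCone.aeval_CX_of_isHomogeneous z (hG e'), Polynomial.coeff_monomial,
        if_neg hne]
    · intro hne; exact absurd he hne
  -- the component of degree `e`
  by_cases he : e ∈ Finset.range (N + 1)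
  · have hx : MvPolynomial.eval z (G e) ∈ maximalIdeal O ^ e := EdgeCone.eval_mem_pow_of_isHomogeneous z hz (hG e)
    have hc := EdgeCone.coeff_mem_pow_succ_of_mem_reesMaxExt hdiff e
    rw [poly_sub, Polynomial.coeff_sub, hcoeffB e he] at hc
    have hA : (ReesRing.poly _ b).coeff e ∈ A e :=
      S04CharAlgebra.coeff_mem_of_mem_familySubalgebra A h0 hmul ((mem_inBl_iff _ _).1 hb) e
    have hm : (ReesRing.poly _ b).coeff e ∈ maximalIdeal O ^ e := ReesRing.coeff_poly_mem _ b e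
    have hmem : MvPolynomial.eval z (G e) ∈ A e ⊓ maximalIdeal O ^ e ⊔ maximalIdeal O ^ (e + 1) :=
      Submodule.mem_sup.2 ⟨(ReesRing.poly _ b).coeff e, ⟨hA, hm⟩, -((ReesRing.poly _ b).coeff e - _),
        neg_mem hc, by ring⟩
    have hin := (nu_blMonomial_mem_edgeAlgebra_iff A h0 hmul e hx).2 hmem
    show MvPolynomial.homogeneousComponent e F ∈ U
    rw [← SetLike.mem_coe, hU, edgeG, Set.mem_preimage, ← hGF e, EdgeCone.polyMap_map_residue,
      EdgeCone.blSubst_eq_blMonomial z hz (hG e) hx]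
    exact hin
  · rw [MvPolynomial.homogeneousComponent_eq_zero]
    · exact zero_mem U
    · rw [Finset.mem_range, not_lt] at he
      exact lt_of_lt_of_le (Nat.lt_succ_self N) he

end Subalgebra

/-! ## The degree-`a` piece: `dim_κ (U ∩ κ[Z]_a) = length_O ((A_a ∩ 𝔪^a + 𝔪^{a+1})/𝔪^{a+1})` -/

section DegreePiece

variable {O : Type u} [CommRing O] [IsLocalRing O] {n : ℕ}
  (z : Fin n → O) (hz : Ideal.span (Set.range z) = maximalIdeal O)

/-- If `G` is a form of degree `a` over `O_ξ` lifting `F ∈ κ[Z]_a` and `polyMap z F = ν(y X^a)`, then `G(z) − y ∈ 𝔪^{a+1}`.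
[folklore] -/
theorem eval_sub_mem_pow_succ_of_polyMap_eq {a : ℕ} {F : MvPolynomial (Fin n) (ResidueField O)}
    {G : MvPolynomial (Fin n) O} (hG : G.IsHomogeneous a) (hGF : MvPolynomial.map (residue O) G = F) {y : O}
    (hy : y ∈ maximalIdeal O ^ a) (h : polyMap z hz F = nu O (blMonomial a y hy)) :
    MvPolynomial.eval z G - y ∈ maximalIdeal O ^ (a + 1) := by
  have hx := EdgeCone.eval_mem_pow_of_isHomogeneous z hz hG
  rw [← hGF, EdgeCone.polyMap_map_residue, EdgeCone.blSubst_eq_blMonomial z hz hG hx] at h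
  exact sub_mem_pow_succ_of_nu_blMonomial_eq hx hy h

/-- **The degree-`a` piece of the edge algebra, counted.** `O` regular local with regular system of parameters `z`
(`n = emb.dim`), `A` a family of ideals with `A 0 = ⊤`, `A b · A c ⊆ A (b + c)`, `U ⊆ κ[Z]` the `κ`-subalgebra with carrier
`edgeG (⊕ A_d X^d) z`. Then the `O`-length of `(A_a ∩ 𝔪^a + 𝔪^{a+1})/𝔪^{a+1} ⊆ O/𝔪^{a+1}` (for `A_d = ℘(E,d)_ξ` this is
`CampaignW31.edgeHilbAt E ξ a`, p464862) equals `dim_κ (U ∩ κ[Z]_a)` (the tree's `EdgeAlgebra.hilbFun U a`). The map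
`F ↦ F̃(z) mod 𝔪^{a+1}` (any lift `F̃`) is an `O`-linear bijection `U_a → (A_a ∩ 𝔪^a + 𝔪^{a+1})/𝔪^{a+1}`: well defined and
injective by `ν(xX^a) = ν(yX^a) ⇔ x − y ∈ 𝔪^{a+1}` and Matsumura 17.10 (tree `EdgeCone.polyMap_injective`), onto by the
membership criterion. [folklore] -/
theorem length_edgePiece_eq_hilbFun (hreg : IsRegularLocalRing O) (hd : (maximalIdeal O).spanFinrank = n)
    (A : ℕ → Ideal O) (h0 : A 0 = ⊤) (hmul : ∀ b c, A b * A c ≤ A (b + c))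
    {U : Subalgebra (ResidueField O) (MvPolynomial (Fin n) (ResidueField O))}
    (hU : (U : Set _) = edgeG (familySubalgebra O A) z hz) (a : ℕ) :
    Module.length O ↥(Submodule.map (maximalIdeal O ^ (a + 1)).mkQ (A a ⊓ maximalIdeal O ^ a)) =
      (EdgeAlgebra.hilbFun U a : ℕ∞) := by
  classical
  set Ua := Subalgebra.toSubmodule U ⊓ MvPolynomial.homogeneousSubmodule (Fin n) (ResidueField O) a with hUa
  set Ma := Submodule.map (maximalIdeal O ^ (a + 1)).mkQ (A a ⊓ maximalIdeal O ^ a) with hMa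
  have hmemU : ∀ F : ↥Ua, (F : MvPolynomial (Fin n) (ResidueField O)) ∈ edgeG (familySubalgebra O A) z hz :=
    fun F => by rw [← hU]; exact (Submodule.mem_inf.1 F.2).1
  have hhom : ∀ F : ↥Ua, (F : MvPolynomial (Fin n) (ResidueField O)).IsHomogeneous a := fun F =>
    (MvPolynomial.mem_homogeneousSubmodule a _).1 (Submodule.mem_inf.1 F.2).2
  -- homogeneous lifts of the members of `U_a`
  choose G hG hGF using fun F : ↥Ua =>
    EdgeCone.exists_lift_isHomogeneous (O := O) (F : MvPolynomial (Fin n) (ResidueField O)) (hhom F)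
  let ψ : ↥Ua → O ⧸ maximalIdeal O ^ (a + 1) := fun F => (maximalIdeal O ^ (a + 1)).mkQ (MvPolynomial.eval z (G F))
  -- any homogeneous lift computes `ψ`
  have hψ : ∀ (F : ↥Ua) (G' : MvPolynomial (Fin n) O), G'.IsHomogeneous a →
      MvPolynomial.map (residue O) G' = F → ψ F = (maximalIdeal O ^ (a + 1)).mkQ (MvPolynomial.eval z G') := by
    intro F G' hG' hG'F
    have hx' := EdgeCone.eval_mem_pow_of_isHomogeneous z hz hG'
    have h1 : polyMap z hz (F : MvPolynomial (Fin n) (ResidueField O)) = nu O (blMonomial a _ hx') := by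
      rw [← hG'F, EdgeCone.polyMap_map_residue, EdgeCone.blSubst_eq_blMonomial z hz hG' hx']
    have h2 := eval_sub_mem_pow_succ_of_polyMap_eq z hz (hG F) (hGF F) hx' h1
    show (maximalIdeal O ^ (a + 1)).mkQ _ = _
    rw [Submodule.mkQ_apply, Submodule.mkQ_apply, Submodule.Quotient.eq]
    exact h2
  let Ψ : ↥Ua →ₗ[O] O ⧸ maximalIdeal O ^ (a + 1) :=
    { toFun := ψ
      map_add' := fun F F' => by
        have e := hψ (F + F') (G F + G F') ((hG F).add (hG F'))
          (by rw [map_add, hGF, hGF, Submodule.coe_add])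
        show ψ (F + F') = ψ F + ψ F'
        rw [e, map_add, map_add]
      map_smul' := fun r F => by
        have hhomog : (MvPolynomial.C r * G F).IsHomogeneous a := by
          simpa using (MvPolynomial.isHomogeneous_C (Fin n) r).mul (hG F)
        have e := hψ (r • F) (MvPolynomial.C r * G F) hhomog (by
          rw [map_mul, MvPolynomial.map_C, hGF, Submodule.coe_smul_of_tower, Algebra.smul_def,
            MvPolynomial.algebraMap_apply, IsLocalRing.ResidueField.algebraMap_eq])
        show ψ (r • F) = r • ψ F
        rw [e, map_mul, MvPolynomial.eval_C, ← smul_eq_mul, map_smul] }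
  -- `Ψ` is injective (Matsumura 17.10)
  have hinj : Function.Injective Ψ := by
    rw [injective_iff_map_eq_zero]
    intro F hF0
    have hx := EdgeCone.eval_mem_pow_of_isHomogeneous z hz (hG F)
    have hmem : MvPolynomial.eval z (G F) ∈ maximalIdeal O ^ (a + 1) := by
      have h : (maximalIdeal O ^ (a + 1)).mkQ (MvPolynomial.eval z (G F)) = 0 := hF0
      rwa [Submodule.mkQ_apply, Submodule.Quotient.mk_eq_zero] at h
    have hpoly : polyMap z hz (F : MvPolynomial (Fin n) (ResidueField O)) = polyMap z hz 0 := by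
      rw [map_zero, ← hGF F, EdgeCone.polyMap_map_residue, EdgeCone.blSubst_eq_blMonomial z hz (hG F) hx,
        EdgeCone.nu_eq_zero_iff]
      exact EdgeCone.blMonomial_mem_reesMaxExt hmem hx
    haveI := hreg
    exact Subtype.ext (EdgeCone.polyMap_injective hd z hz hpoly)
  -- the range of `Ψ` is `M_a`
  have hrange : LinearMap.range Ψ = Ma := by
    apply le_antisymm
    · rintro _ ⟨F, rfl⟩
      have hx := EdgeCone.eval_mem_pow_of_isHomogeneous z hz (hG F)
      have hin : nu O (blMonomial a _ hx) ∈ edgeAlgebra (familySubalgebra O A) := by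
        rw [← EdgeCone.blSubst_eq_blMonomial z hz (hG F) hx, ← EdgeCone.polyMap_map_residue, hGF]
        exact hmemU F
      obtain ⟨y, hy, w, hw, hyw⟩ :=
        Submodule.mem_sup.1 ((nu_blMonomial_mem_edgeAlgebra_iff A h0 hmul a hx).1 hin)
      refine ⟨y, hy, ?_⟩
      show (maximalIdeal O ^ (a + 1)).mkQ y = (maximalIdeal O ^ (a + 1)).mkQ (MvPolynomial.eval z (G F))
      rw [Submodule.mkQ_apply, Submodule.mkQ_apply, Submodule.Quotient.eq]
      have e : y - MvPolynomial.eval z (G F) = -w := by rw [← hyw]; ring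
      rw [e]
      exact neg_mem hw
    · rintro _ ⟨y, ⟨hyA, hym⟩, rfl⟩
      obtain ⟨F, hF, hFy⟩ := EdgeCone.exists_form_of_mem_pow z hz a y hym
      have hFU : F ∈ U := by
        rw [← SetLike.mem_coe, hU, edgeG, Set.mem_preimage, hFy]
        exact (nu_blMonomial_mem_edgeAlgebra_iff A h0 hmul a hym).2 (Submodule.mem_sup_left ⟨hyA, hym⟩)
      have hFUa : F ∈ Ua :=
        Submodule.mem_inf.2 ⟨hFU, (MvPolynomial.mem_homogeneousSubmodule a F).2 hF⟩
      refine ⟨⟨F, hFUa⟩, ?_⟩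
      have h2 := eval_sub_mem_pow_succ_of_polyMap_eq z hz (hG ⟨F, hFUa⟩) (hGF ⟨F, hFUa⟩) hym hFy
      show (maximalIdeal O ^ (a + 1)).mkQ (MvPolynomial.eval z (G ⟨F, hFUa⟩)) = (maximalIdeal O ^ (a + 1)).mkQ y
      rw [Submodule.mkQ_apply, Submodule.mkQ_apply, Submodule.Quotient.eq]
      exact h2
  -- count
  have e1 : Module.length O ↥Ma = Module.length O ↥Ua := by
    rw [← hrange]
    exact (LinearEquiv.ofInjective Ψ hinj).length_eq.symm
  have e2 : Module.length O ↥Ua = Module.length (ResidueField O) ↥Ua :=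
    Module.length_eq_of_surjective (S := O) (R := ResidueField O) residue_surjective
  have hle : Ua ≤ MvPolynomial.restrictTotalDegree (Fin n) (ResidueField O) a := fun F hF =>
    (MvPolynomial.mem_restrictTotalDegree _ _ _).2
      ((MvPolynomial.mem_homogeneousSubmodule a F).1 (Submodule.mem_inf.1 hF).2).totalDegree_le
  haveI : Module.Finite (ResidueField O) ↥Ua :=
    Module.Finite.of_injective (Submodule.inclusion hle) (Submodule.inclusion_injective hle)
  rw [e1, e2, Module.length_eq_finrank]
  rfl

end DegreePiece

/-! ## Scheme level: `edgeHilbAt E ξ a = dim_κ (G(ξ) ∩ κ[Z]_a)` -/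

section Scheme

open _root_.AlgebraicGeometry

variable {Z : Scheme.{u}}

/-- The stalk family `d ↦ ℘(E,d)_ξ` of the geometric `℘` starts with `℘(E,0)_ξ = O_ξ` (tree `pAlg_zero`,
`stalkIdeal_top`). [folklore] -/
theorem stalkIdeal_pAlg_zero (E : IdealExponent Z) (ξ : Z) : stalkIdeal (pAlg E 0) ξ = ⊤ := by
  rw [pAlg_zero, stalkIdeal_top]

/-- **[OURS · L1 W3.1] THE EDGE-PIECE BRIDGE** (replaces nothing printed; plumbing between row 003/005's carriers and
the tree's subalgebra calculus; NOT a statement of the manuscript). On a regular locally Noetherian scheme `Z`, at a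
point `ξ` whose local ring is regular with regular system of parameters `z` (row 004's `IsRSP`, `n = emb.dim O_ξ`), for
every `κ(ξ)`-subalgebra `U ⊆ κ(ξ)[Z_1,…,Z_n]` whose carrier is row 004's `edgeG (℘(E)_ξ) z` (the edge algebra
`ν(℘(E)_ξ)` of Def. 4.6 read in the coordinates `z̄`): the typed Hilbert function of the edge algebra
(`CampaignW31.edgeHilbAt E ξ a`, p464862: the `O_ξ`-length of the image of `℘(E,a)_ξ ∩ 𝔪^a` in `O_ξ/𝔪^{a+1}`) IS the
Hilbert function `dim_κ (U ∩ κ[Z]_a)` of `U` (tree `EdgeAlgebra.hilbFun`). [folklore] -/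
theorem edgeHilbAt_eq_hilbFun [IsLocallyNoetherian Z] (hR : Scheme.IsRegular Z) (E : IdealExponent Z) (ξ : Z) {n : ℕ}
    {z : Fin n → Z.presheaf.stalk ξ} (hz : IsRSP (Z.presheaf.stalk ξ) z)
    {U : Subalgebra (ResidueField (Z.presheaf.stalk ξ)) (MvPolynomial (Fin n) (ResidueField (Z.presheaf.stalk ξ)))}
    (hU : (U : Set _) = edgeG (pStalk E ξ) z hz.2.1) (a : ℕ) :
    edgeHilbAt E ξ a = (EdgeAlgebra.hilbFun U a : ℕ∞) :=
  length_edgePiece_eq_hilbFun z hz.2.1 hz.1 hz.2.2 (fun d => stalkIdeal (pAlg E d) ξ) (stalkIdeal_pAlg_zero E ξ)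
    (stalkIdeal_pAlg_mul_le hR E ξ) hU a

/-- **[OURS · L1 W3.1] gradedness of the pulled-back edge algebra** at such a point: the `κ(ξ)`-subalgebra with carrier
`edgeG (℘(E)_ξ) z` contains the homogeneous components of its members (tree `Resolution.IsGradedSubalgebra`) — the
«graded `K`-algebra» clause of p.19 l.41 – p.20 l.1 for OUR carriers, on a regular locally Noetherian `Z`. NOT a statement of
the manuscript. [folklore] -/
theorem isGradedSubalgebra_edgeG [IsLocallyNoetherian Z] (hR : Scheme.IsRegular Z) (E : IdealExponent Z) (ξ : Z)
    {n : ℕ} {z : Fin n → Z.presheaf.stalk ξ}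
    (hz : Ideal.span (Set.range z) = maximalIdeal (Z.presheaf.stalk ξ))
    {U : Subalgebra (ResidueField (Z.presheaf.stalk ξ)) (MvPolynomial (Fin n) (ResidueField (Z.presheaf.stalk ξ)))}
    (hU : (U : Set _) = edgeG (pStalk E ξ) z hz) : IsGradedSubalgebra U :=
  isGradedSubalgebra_of_coe_eq_edgeG z hz (fun d => stalkIdeal (pAlg E d) ξ) (stalkIdeal_pAlg_zero E ξ)
    (stalkIdeal_pAlg_mul_le hR E ξ) hU

end Scheme

end CampaignW31

end Summit.ResolutionOfSingularities.ResolutionOfSingularities.Theorems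

end
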